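import Summits.Schanuel.Schanuel.Theorems.DiophantineDichotomyKhovanskiiApproxTypeEvDefs
import Summits.Schanuel.Schanuel.Theorems.EPiSimultaneousType.Negative.OfKhovanskiiApproxType
import Literature.NumberTheory.Transcendental.GelfondExpLogConjectureProofs
import HarnessLib

/-!
# Line `anchored-reduction` (crux `KhovanskiiApproxTypeEv`, stmt-Schanuel-14972): the `n = 2` layer of
# the anchored crux is the flagship `EPiSimultaneousTypeEv`

Route `DiophantineDichotomy`, sub-problem `Schanuel/Schanuel`; line lead
`prover-line-stmt-Schanuel-14972-0`, skeleton `Cruxes/KhovanskiiApproxTypeEv/Lines/Sketch.lean`.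

After the anchored reduction (`stub_anchoredReduction`, `stub_unanchoring`, `stub_raceAnchored`, all
landed) the route consumes the Diophantine crux only on anchored free Khovanskii points
`s = (1, iπ, s₂, …)`; at `n = 2` there is exactly ONE such point, `s = (1, iπ)` (`anchored_two_eq`),
`θ = (1, iπ, e, −1)`.  This file kernel-checks, in the EVENTUAL currency of the crux, that the crux
there is exactly the route item `EPiSimultaneousTypeEv` (stmt-Schanuel-14975, the eventual
simultaneous approximation measure for the pair `(π, e)` with `a < 1`):

* `evAt_anchor_of_flagship` (registered sub-goal of the line) — `EPiSimultaneousTypeEv` ⇒ eventual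
  type `a < 1` at `(1, iπ)`: descent of challengers `(γ₁, γ₂, γ₃, γ₄) ↦ (−iγ₂, γ₃)` at level
  `(2d, (2d+1)H²)`, constants `(a, max(a+1,b), C(2^{|a|+1} + 2^{|b|}))`, threshold `H₀(d) := H₀'(2d)`;
* `flagship_of_evAt_anchor` — the converse (lift `(γ₁, γ₂) ↦ (1, iγ₁, γ₂, −1)`), so the line's open
  stub `stub_evNonLW_two : EvNonLWTwo` CONTAINS the flagship (`flagship_of_evNonLW_two`): it is of
  Schanuel-rank-2 strength (e ⊥ π with a measure, via the landed `ePiRaceEv_proof`), as conceded;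
* `evAnchored_two_of_flagship` — the `n = 0` layer of `KhovanskiiApproxTypeEvAnchored` from the flagship.

Everything is the eventual-threshold version of the landed all-heights bookkeeping
`Theorems/EPiSimultaneousType/Negative/OfKhovanskiiApproxType.lean` (`measureAt_one_I_pi_of_epiSimultaneousType`,
`khovanskiiApproxType_false_of_not_epiSimultaneousType`), whose clause/height/finrank lemmas are reused.
No named facts; sorry-free.
-/

noncomputable section

-- `Summit.Schanuel.Schanuel.…` is the mandated summit/sub-problem namespace (single-conjunct summit), hence:
set_option linter.dupNamespace false

namespace Summit.Schanuel.Schanuel.Cruxes.KhovanskiiApproxTypeEv.AnchoredReduction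

open Summit.Schanuel.Schanuel.Theses.DiophantineDichotomy (EPiSimultaneousTypeEv)
open Summit.Schanuel.Schanuel.Theorems
open Complex Polynomial

/-- An anchored pair is literally `(1, iπ)`. -/
theorem anchored_two_eq (s : Fin 2 → ℂ) (h0 : s 0 = 1) (h1 : s 1 = Complex.I * Real.pi) :
    s = ![(1 : ℂ), I * Real.pi] := by
  funext i
  fin_cases i
  · simpa using h0
  · simpa using h1

/-- **The flagship gives the eventual crux AT `s = (1, iπ)`** (eventual form of the landed
`measureAt_one_I_pi_of_epiSimultaneousType`): descent of challengers `(γ₁, γ₂, γ₃, γ₄) ↦ (−iγ₂, γ₃)` at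
level `(2d, (2d+1)H²)`, constants `(a, max(a+1, b), C(2^{|a|+1} + 2^{|b|}))`, threshold
`H₀(d) := H₀'(2d)` (as `(2d+1)H² ≥ H ≥ H₀'(2d)`).  So after the anchored reduction the ROUTE's whole
`n = 2` Diophantine need is the single route item `EPiSimultaneousTypeEv` (stmt-Schanuel-14975). -/
theorem evAt_anchor_of_flagship :
    EPiSimultaneousTypeEv → ∃ a b C : ℝ, a < 1 ∧ ApproxTypeEvAt 2 ![(1 : ℂ), I * Real.pi] a b C := by
  rintro ⟨a, b, C0, ha, hC, hM⟩
  choose H₀ hH₀ using hM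
  refine ⟨a, max (a + 1) b, C0 * (2 ^ (|a| + 1) + 2 ^ |b|), ha, by positivity, fun d => ⟨H₀ (2 * d), ?_⟩⟩
  intro H γ hH hfin hcl
  obtain ⟨hd1, hH1⟩ := EPiSimultaneousType.one_le_of_clause' (hcl (Sum.inl 0))
  obtain ⟨hH', -⟩ := EPiSimultaneousType.height_lift_le (d := d) hH1
  -- the descended challenger
  set p : Fin 2 → ℂ := ![-I * γ (Sum.inl 1), γ (Sum.inr 0)] with hp
  have hfinp : Module.finrank ℚ ↥(IntermediateField.adjoin ℚ (Set.range p)) ≤ 2 * d :=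
    (EPiSimultaneousType.finrank_descent_le γ
      (fun i => EPiSimultaneousType.isIntegral_of_clause (hcl i))).trans (Nat.mul_le_mul_left 2 hfin)
  have hclp : ∀ i, ∃ P : Polynomial ℤ, P ≠ 0 ∧ P.natDegree ≤ 2 * d ∧
      (∀ k, |P.coeff k| ≤ (((2 * d + 1) * H ^ 2 : ℕ) : ℤ)) ∧ Polynomial.aeval (p i) P = 0 := by
    intro i
    fin_cases i
    · have := EPiSimultaneousType.clause_I_mul (EPiSimultaneousType.clause_neg (hcl (Sum.inl 1)))
      simpa [hp] using this
    · obtain ⟨P, hP0, hdeg, hHt, hroot⟩ := hcl (Sum.inr 0)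
      exact ⟨P, hP0, by omega, fun k => (hHt k).trans hH', by simpa [hp] using hroot⟩
  have hthr : H₀ (2 * d) ≤ (2 * d + 1) * H ^ 2 := by
    have h1 : H ≤ (2 * d + 1) * H ^ 2 := by exact_mod_cast hH'
    exact hH.trans h1
  have hmeas := hH₀ (2 * d) ((2 * d + 1) * H ^ 2) p hthr hfinp hclp
  have hdist : ‖p - ![(Real.pi : ℂ), (Real.exp 1 : ℂ)]‖ ≤
      ‖γ - Sum.elim ![(1 : ℂ), I * Real.pi] (Complex.exp ∘ ![(1 : ℂ), I * Real.pi])‖ := by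
    rw [pi_norm_le_iff_of_nonneg (norm_nonneg _)]
    intro i
    fin_cases i
    · show ‖(p - ![(Real.pi : ℂ), (Real.exp 1 : ℂ)]) 0‖ ≤ _
      have := norm_le_pi_norm
        (γ - Sum.elim ![(1 : ℂ), I * Real.pi] (Complex.exp ∘ ![(1 : ℂ), I * Real.pi])) (Sum.inl 1)
      have e : (p - ![(Real.pi : ℂ), (Real.exp 1 : ℂ)]) 0 = -I * ((γ - Sum.elim ![(1 : ℂ), I * Real.pi]
          (Complex.exp ∘ ![(1 : ℂ), I * Real.pi])) (Sum.inl 1)) := by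
        simp only [hp, Pi.sub_apply, Sum.elim_inl, Matrix.cons_val_zero, Matrix.cons_val_one,
          Matrix.cons_val_fin_one]
        ring_nf
        rw [Complex.I_sq]
        ring
      rw [e, norm_mul]
      simpa using this
    · have := norm_le_pi_norm
        (γ - Sum.elim ![(1 : ℂ), I * Real.pi] (Complex.exp ∘ ![(1 : ℂ), I * Real.pi])) (Sum.inr 0)
      simpa [hp, Complex.ofReal_exp] using this
  refine le_trans ?_ (hmeas.trans hdist)
  rw [Real.exp_le_exp, neg_le_neg_iff]
  exact EPiSimultaneousType.transfer_constants hC.le hd1 hH1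

/-- **Conversely, the eventual crux at `(1, iπ)` gives the flagship** (eventual form of the landed
`khovanskiiApproxType_false_of_not_epiSimultaneousType`): lift `(γ₁, γ₂) ↦ (1, iγ₁, γ₂, −1)` at level
`(2d, (2d+1)H²)`, same constants, threshold `H₀(d) := H₀'(2d)`.  Hence the open stub `stub_evNonLW_two`
CONTAINS the route item `EPiSimultaneousTypeEv` (e ⊥ π with a measure, via the landed `ePiRaceEv_proof`
and the known `t = 1` approximation property): Schanuel-rank-2 strength, as conceded. -/
theorem flagship_of_evAt_anchor {a b C0 : ℝ} (ha : a < 1)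
    (hM : ApproxTypeEvAt 2 ![(1 : ℂ), I * Real.pi] a b C0) : EPiSimultaneousTypeEv := by
  obtain ⟨hC, hM⟩ := hM
  choose H₀ hH₀ using hM
  refine ⟨a, max (a + 1) b, C0 * (2 ^ (|a| + 1) + 2 ^ |b|), ha, by positivity, fun d => ⟨H₀ (2 * d), ?_⟩⟩
  intro H γ hH hfin hcl
  obtain ⟨hd1, hH1⟩ := EPiSimultaneousType.one_le_of_clause' (hcl 0)
  obtain ⟨hH', h1''⟩ := EPiSimultaneousType.height_lift_le (d := d) hH1
  -- the lifted challenger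
  set γ4 : Fin 2 ⊕ Fin 2 → ℂ := Sum.elim ![(1 : ℂ), I * γ 0] ![γ 1, -1] with hγ4
  have hfin4 : Module.finrank ℚ ↥(IntermediateField.adjoin ℚ (Set.range γ4)) ≤ 2 * d :=
    (EPiSimultaneousType.finrank_lift_le γ
      (fun i => EPiSimultaneousType.isIntegral_of_clause (hcl i))).trans (Nat.mul_le_mul_left 2 hfin)
  have hcl4 : ∀ i, ∃ P : Polynomial ℤ, P ≠ 0 ∧ P.natDegree ≤ 2 * d ∧
      (∀ k, |P.coeff k| ≤ (((2 * d + 1) * H ^ 2 : ℕ) : ℤ)) ∧ Polynomial.aeval (γ4 i) P = 0 := by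
    rintro (i | i) <;> fin_cases i
    · refine ⟨X - C 1, X_sub_C_ne_zero 1, by rw [natDegree_X_sub_C]; omega, fun k => ?_, by simp [hγ4]⟩
      rw [coeff_sub, coeff_X, coeff_C]
      rcases k with _ | _ | k
      · simpa using h1''
      · simpa using h1''
      · simp
    · simpa [hγ4] using EPiSimultaneousType.clause_I_mul (hcl 0)
    · obtain ⟨P, hP0, hdeg, hHt, hroot⟩ := hcl 1
      exact ⟨P, hP0, by omega, fun k => (hHt k).trans hH', by simpa [hγ4] using hroot⟩
    · refine ⟨X + C 1, X_add_C_ne_zero 1, by rw [natDegree_X_add_C]; omega, fun k => ?_, by simp [hγ4]⟩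
      rw [coeff_add, coeff_X, coeff_C]
      rcases k with _ | _ | k
      · simpa using h1''
      · simpa using h1''
      · simp
  have hthr : H₀ (2 * d) ≤ (2 * d + 1) * H ^ 2 := by
    have h1 : H ≤ (2 * d + 1) * H ^ 2 := by exact_mod_cast hH'
    exact hH.trans h1
  have hmeas := hH₀ (2 * d) ((2 * d + 1) * H ^ 2) γ4 hthr hfin4 hcl4
  have hdist : ‖γ4 - Sum.elim ![(1 : ℂ), I * Real.pi] (Complex.exp ∘ ![(1 : ℂ), I * Real.pi])‖ ≤
      ‖γ - ![(Real.pi : ℂ), (Real.exp 1 : ℂ)]‖ := by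
    rw [pi_norm_le_iff_of_nonneg (norm_nonneg _)]
    rintro (i | i) <;> fin_cases i
    · simp [hγ4]
    · have := norm_le_pi_norm (γ - ![(Real.pi : ℂ), (Real.exp 1 : ℂ)]) 0
      simpa [hγ4, ← mul_sub, norm_mul] using this
    · have := norm_le_pi_norm (γ - ![(Real.pi : ℂ), (Real.exp 1 : ℂ)]) 1
      simpa [hγ4, Complex.ofReal_exp] using this
    · simp [hγ4]
      rw [mul_comm, Complex.exp_pi_mul_I]; simp
  refine le_trans ?_ (hmeas.trans hdist)
  rw [Real.exp_le_exp, neg_le_neg_iff]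
  exact EPiSimultaneousType.transfer_constants hC.le hd1 hH1

/-- `stub_evNonLW_two` contains the flagship: `EvNonLWTwo → EPiSimultaneousTypeEv` (`(1, iπ)` is a free
Khovanskii point with the transcendental coordinate `iπ`). -/
theorem flagship_of_evNonLW_two (hN : EvNonLWTwo) : EPiSimultaneousTypeEv := by
  have htr : ∃ i, Transcendental ℚ (![(1 : ℂ), I * Real.pi] i) :=
    ⟨1, by simpa [mul_comm] using Literature.NumberTheory.Transcendental.transcendental_pi_mul_I⟩
  obtain ⟨a, b, C, ha, hM⟩ := hN ![(1 : ℂ), I * Real.pi] EPiSimultaneousType.linearIndependent_one_I_pi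
    EPiSimultaneousType.khovanskiiSystem_one_I_pi htr
  exact flagship_of_evAt_anchor ha hM

/-- **The `n = 2` layer of the anchored crux is the flagship**: `EPiSimultaneousTypeEv` gives
`KhovanskiiApproxTypeEvAnchored` at every anchored `s : Fin 2 → ℂ` (there is exactly one,
`anchored_two_eq`). -/
theorem evAnchored_two_of_flagship (h : EPiSimultaneousTypeEv) (s : Fin (0 + 2) → ℂ) (h0 : s 0 = 1)
    (h1 : s 1 = Complex.I * Real.pi) :
    ∃ a b C : ℝ, a < 1 / (((0 + 2 : ℕ) : ℝ) - 1) ∧ ApproxTypeEvAt (0 + 2) s a b C := by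
  obtain rfl := anchored_two_eq s h0 h1
  obtain ⟨a, b, C, ha, hat⟩ := evAt_anchor_of_flagship h
  exact ⟨a, b, C, by norm_num; exact ha, hat⟩

/-! ## Appended (line lead, cycle 1): the flagship is an INSTANCE of the crux as filed — the route's
kill switch K2 in the eventual currency -/

/-- **The crux as filed implies the flagship**: `KhovanskiiApproxTypeEv → EPiSimultaneousTypeEv`
(instance `n = 2`, `s = (1, iπ)` — a free Khovanskii point by `khovanskiiSystem_one_I_pi` — then
`flagship_of_evAt_anchor`).  So item stmt-Schanuel-14975 is implied by item stmt-Schanuel-14972. -/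
theorem flagship_of_ev (hEv : Summit.Schanuel.Schanuel.Theses.DiophantineDichotomy.KhovanskiiApproxTypeEv) :
    EPiSimultaneousTypeEv := by
  obtain ⟨a, b, C, ha, hM⟩ := khovanskiiApproxTypeEv_iff.1 hEv 2 ![(1 : ℂ), I * Real.pi] le_rfl
    EPiSimultaneousType.linearIndependent_one_I_pi EPiSimultaneousType.khovanskiiSystem_one_I_pi
  exact flagship_of_evAt_anchor (by norm_num at ha; exact ha) hM

/-- **Kill switch K2, eventual currency**: a refutation of the flagship `EPiSimultaneousTypeEv` refutes the
crux `KhovanskiiApproxTypeEv` as filed (contrapositive of `flagship_of_ev`). -/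
theorem khovanskiiApproxTypeEv_false_of_not_flagship (hne : ¬ EPiSimultaneousTypeEv) :
    ¬ Summit.Schanuel.Schanuel.Theses.DiophantineDichotomy.KhovanskiiApproxTypeEv :=
  fun hEv => hne (flagship_of_ev hEv)

end Summit.Schanuel.Schanuel.Cruxes.KhovanskiiApproxTypeEv.AnchoredReduction

end
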